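import Literature.AlgebraicGeometry.Resolution.AlterationsStrictTransformProofs
import Literature.AlgebraicGeometry.Resolution.AlterationsStableModelMorphism
import Literature.AlgebraicGeometry.Resolution.RelativeDimensionCurve
import Literature.AlgebraicGeometry.Motives.GoodReductionSpecialFibreProofs
import HarnessLib

/-!
# De Jong's alteration theorem, 4.15 PROVED: the strict transform of a fibred pair

Topic: `Literature/AlgebraicGeometry/Resolution`. DISCHARGE of the named fact
`DeJong1996StrictTransform` (`AlterationsStrictTransform.lean`; de Jong 1996, 4.15):

> "4.15. Assume (i)–(v), (vi) a)–e). In the sequel we will consider projective alterations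
> `ψ : Y' → Y`, which are generically étale. […] Here `X'` is the reduction of the scheme
> `Y' ×_Y X` […]. Put `Z' = pr₂⁻¹(Z)_red` […]. It is easy to see that the morphism `f'` satisfies
> (vi) a)–c); from this we conclude that `X'` is irreducible. Thus `φ : X' → X` is a projective
> alteration which is generically étale. Conditions (i), (iii) and (iv) are all right for the
> pair `(X', Z')`, but (v) may fail, for example if `Y'` is not normal. Finally, (vi) d) is
> trivial to verify for `f'|_{Z'}` and (vi) e) holds since `φ⁻¹(sm(X/Y)) ⊂ sm(X'/Y')`." (p. 71)

Continuing `AlterationsStrictTransformProofs.lean` ((vi) a)–c) for `f' = ι ≫ pr_{Y'}`, `φ` an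
alteration, the irreducibility criterion) for a surjective closed immersion
`ι : X' → X ×_Y Y'` from a reduced scheme, everything here is PROVED:

* **`X'` is integral** (`StrictTransform.isIntegral`): the generic fibre of `f'` is smooth over
  `κ(η')` and connected, hence irreducible (its local rings are domains, Stacks 056S;
  Görtz–Wedhorn I, Exercise 3.16, `Motives.irreducibleSpace_of_isDomain_stalk`), and the smooth
  locus of `f'` is dense in every fibre, so `X'` is irreducible
  (`StrictTransform.irreducibleSpace_of_dense_smoothLocus`), and it is reduced;
* **(iii)** `X'` is projective over `k` (`StrictTransform.isProjectiveOver`: a closed subscheme of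
  `X ×_Y Y'`, projective by `isProjectiveOver_pullback`); **(iv)** `Z' = φ⁻¹(Z)` is the support of
  the pulled-back divisor (`StrictTransform.exists_isEffectiveCartier`, 4.10);
* **(vi) d)** (`StrictTransform.isFiniteGenericallyEtaleOn`): `Z'_red` is a closed subscheme of the
  finite `Y'`-scheme `Z_red ×_Y Y'` onto which it maps, so `f'|_{Z'}` is finite; it is étale on
  the preimage of the étale locus `V₀` of `f|_Z` (over which `Z_red ×_Y Y'` is étale, hence
  reduced, so that `Z'_red → Z_red ×_Y Y'` is an isomorphism there), and that preimage is dense: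
  every point of `Z'` is a specialisation of a point of `Z'` of coheight `≤ 1` (Krull, (iv)),
  which lies over the generic point of `Y'` ("any component dominates",
  `apply_eq_genericPoint_of_coheight_le_one`), hence over the generic point of `Y`, where `Z_red`
  has only generic points of components (`f|_Z` finite), all inside the dense open `V₀`;
* **(vi) e)** (`StrictTransform.hasThreeSmoothPoints`): geometric fibres of `f'` are homeomorphic,
  over `φ`, to geometric fibres of `f`, and `φ⁻¹(sm(X/Y)) ⊆ sm(X'/Y')`;
* **`DeJong1996StrictTransform_holds`** — the named fact, with `X' = (X ×_Y Y')_red` the reduced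
  closed subscheme of Mathlib's `pullback f ψ` on its whole space; and the consequences
  `DeJong1996SectionsReduction.of_galoisNormalization` (4.15–4.16 from the Galois normalisation
  4.16 alone) and
  `DeJong1996MultisectionToPreSemiStablePair.of_galoisNormalization_of_stableModel_of_toMorphism`
  (4.15–4.22a from 4.16, 4.17 and 4.18–4.21 + opening of 4.22).

## Sources

* A. J. de Jong, *Smoothness, semi-stability and alterations*, Publ. Math. IHÉS 83 (1996) 51–93:
  2.20 (p. 61), 4.4, 4.10 (pp. 66–67), 4.15–4.16 (p. 71).
* Q. Liu, *Algebraic Geometry and Arithmetic Curves* (2002), Prop. 4.3.8.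
* U. Görtz, T. Wedhorn, *Algebraic Geometry I: Schemes*, 2nd ed. (2020), Exercise 3.16.
* The Stacks Project, Tag 056S.
-/

noncomputable section

open CategoryTheory CategoryTheory.Limits AlgebraicGeometry TopologicalSpace Topology

namespace Literature.AlgebraicGeometry.Resolution

universe u

namespace DeJong1996.StrictTransform

variable {X Y Y' X' : Scheme.{u}} (f : X ⟶ Y) (ψ : Y' ⟶ Y) (ι : X' ⟶ pullback f ψ)
  [IsClosedImmersion ι] [Surjective ι]

/-! ## The generic fibre of `f'` is irreducible; `X'` is integral -/

/-- **The generic fibre of `f'` is irreducible**: it is smooth over `κ(η')`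
(`smooth_fiberToSpecResidueField_genericPoint_comp_snd`), so its local rings are domains
(`isDomain_stalk_of_smooth`, Stacks 056S), and connected (the fibres of `f'` are geometrically
connected), hence irreducible (`Motives.irreducibleSpace_of_isDomain_stalk`, Görtz–Wedhorn I,
Exercise 3.16). [folklore] -/
theorem irreducibleSpace_fiber_genericPoint_comp_snd [IsIntegral Y] [IsIntegral Y']
    [IsDominant ψ] [GeometricallyConnected f] [LocallyOfFinitePresentation (ι ≫ pullback.snd f ψ)]
    (hf : Smooth (f.fiberToSpecResidueField (genericPoint Y))) :
    IrreducibleSpace ↥((ι ≫ pullback.snd f ψ).fiber (genericPoint Y')) := by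
  haveI : GeometricallyConnected (ι ≫ pullback.snd f ψ) := geometricallyConnected_comp_snd f ψ ι
  have hsm := smooth_fiberToSpecResidueField_genericPoint_comp_snd f ψ ι hf
  haveI : IsLocallyNoetherian ((ι ≫ pullback.snd f ψ).fiber (genericPoint Y')) :=
    LocallyOfFiniteType.isLocallyNoetherian
      ((ι ≫ pullback.snd f ψ).fiberToSpecResidueField (genericPoint Y'))
  exact Literature.AlgebraicGeometry.Motives.irreducibleSpace_of_isDomain_stalk _ fun z =>
    @isDomain_stalk_of_smooth _ _ _
      ((ι ≫ pullback.snd f ψ).fiberToSpecResidueField (genericPoint Y')) hsm z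

/-- **"from this we conclude that `X'` is irreducible"** (de Jong 1996, 4.15), indeed integral,
`X'` being reduced: (vi) b) and c) for `f'` (`dense_preimage_smoothLocus_comp_snd`,
`irreducibleSpace_fiber_genericPoint_comp_snd`) and `irreducibleSpace_of_dense_smoothLocus`.
[cite: DeJong1996, 4.15, p. 71] -/
theorem isIntegral [IsIntegral Y] [IsIntegral Y'] [IsDominant ψ] [GeometricallyConnected f]
    [LocallyOfFinitePresentation f] [LocallyOfFinitePresentation (ι ≫ pullback.snd f ψ)]
    [IsReduced X'] [Nonempty X'] (hf : Smooth (f.fiberToSpecResidueField (genericPoint Y)))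
    (hb : ∀ y : Y, Dense ((f.fiberι y) ⁻¹' (f.smoothLocus : Set X))) : IsIntegral X' := by
  haveI := irreducibleSpace_fiber_genericPoint_comp_snd f ψ ι hf
  haveI : IrreducibleSpace X' := irreducibleSpace_of_dense_smoothLocus (ι ≫ pullback.snd f ψ)
    (dense_preimage_smoothLocus_comp_snd f ψ ι hb)
  exact isIntegral_of_irreducibleSpace_of_isReduced X'

/-! ## (iii) and (iv) for `(X', Z')` -/

omit [Surjective ι] in
/-- **(iii) for `X'`**: `X'` is projective over `k` — a closed subscheme of `X ×_Y Y'`, which is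
projective over `k` (`isProjectiveOver_pullback`: a closed subscheme of `X ×_k Y'`, projective by
the Segre embedding). [cite: DeJong1996, 4.15, p. 71] -/
theorem isProjectiveOver {k : Type u} [Field k] (g : Y ⟶ Spec (.of k)) [IsSeparated g]
    (hX : Literature.AlgebraicGeometry.Motives.IsProjectiveOver (Over.mk (f ≫ g)))
    (hY' : Literature.AlgebraicGeometry.Motives.IsProjectiveOver (Over.mk (ψ ≫ g))) :
    Literature.AlgebraicGeometry.Motives.IsProjectiveOver
      (Over.mk ((ι ≫ pullback.snd f ψ) ≫ ψ ≫ g)) := by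
  have hP := isProjectiveOver_pullback f g ψ (ψ ≫ g) rfl hX hY'
  let j : (Over.mk ((ι ≫ pullback.snd f ψ) ≫ ψ ≫ g) : Literature.AlgebraicGeometry.Motives.SchemeOver k) ⟶
      Over.mk (pullback.snd f ψ ≫ ψ ≫ g) := Over.homMk ι rfl
  haveI : IsClosedImmersion j.left := inferInstanceAs (IsClosedImmersion ι)
  exact isProjectiveOver_of_isClosedImmersion_left j hP

/-- **(iv) for `(X', Z')`**: `Z' = φ⁻¹(Z)` is the support of the effective Cartier divisor pulled
back along the dominant `φ` (4.10, `IsEffectiveCartier.comap_of_isDominant`).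
[cite: DeJong1996, 4.10 and 4.15, pp. 67, 71] -/
theorem exists_isEffectiveCartier [IsIntegral X] [IsIntegral X'] [IsProper ψ] [Surjective ψ]
    {Z : Set X} (hD : ∃ I : X.IdealSheafData, IsEffectiveCartier I ∧ (I.support : Set X) = Z) :
    ∃ I' : X'.IdealSheafData, IsEffectiveCartier I' ∧
      (I'.support : Set X') = (ι ≫ pullback.fst f ψ) ⁻¹' Z := by
  haveI : IsDominant (ι ≫ pullback.fst f ψ) :=
    ⟨(ι ≫ pullback.fst f ψ).surjective.denseRange⟩
  obtain ⟨D, hDc, hDZ⟩ := hD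
  refine ⟨D.comap (ι ≫ pullback.fst f ψ), hDc.comap_of_isDominant _, ?_⟩
  rw [Scheme.IdealSheafData.support_comap, TopologicalSpace.Closeds.coe_preimage, hDZ]

/-! ## (vi) e) for `(X', Z')` -/

/-- **(vi) e) for `(X', Z')`** (de Jong 1996, 4.15: "(vi) e) holds since
`φ⁻¹(sm(X/Y)) ⊂ sm(X'/Y')`"): the geometric fibre of `f'` at `ȳ : Spec K → Y'` maps
homeomorphically onto the geometric fibre of `f` at `ȳ ≫ ψ` (a surjective closed immersion
followed by `(X ×_Y Y') ×_{Y'} Spec K ≅ X ×_Y Spec K`), compatibly with `φ`; components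
correspond, and the three points of a component in the preimage of `sm(X/Y) ∩ Z` pull back to
three points of the corresponding component in the preimage of `sm(X'/Y') ∩ Z'`, because
`φ⁻¹(sm(X/Y)) ⊆ sm(X'/Y')` (`preimage_preimage_smoothLocus_le`) and `Z' = φ⁻¹(Z)`.
[cite: DeJong1996, 4.15, p. 71] -/
theorem hasThreeSmoothPoints [LocallyOfFinitePresentation f] [IsIntegral Y']
    [LocallyOfFinitePresentation (ι ≫ pullback.snd f ψ)] {Z : Set X}
    (h3 : HasThreeSmoothPoints f Z) :
    HasThreeSmoothPoints (ι ≫ pullback.snd f ψ) ((ι ≫ pullback.fst f ψ) ⁻¹' Z) := by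
  intro K _ _ y C' hC'
  -- the homeomorphism `X' ×_{Y'} Spec K → X ×_Y Spec K` over `φ`
  obtain ⟨c, hc, hcs, -, hcf⟩ := exists_fibreComparison f ψ ι y
  haveI := hc
  haveI := hcs inferInstance
  let d := pullbackLeftPullbackSndIso f ψ y
  let e' : pullback (ι ≫ pullback.snd f ψ) y ⟶ pullback f (y ≫ ψ) := c ≫ d.hom
  haveI : IsClosedImmersion e' := inferInstance
  haveI : Surjective e' := inferInstance
  have he' : e' ≫ pullback.fst f (y ≫ ψ) = pullback.fst (ι ≫ pullback.snd f ψ) y ≫ ι ≫ pullback.fst f ψ := by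
    simp only [e', d, Category.assoc, pullbackLeftPullbackSndIso_hom_fst]
    rw [← Category.assoc, hcf, Category.assoc]
  let e := (isHomeomorph_of_isClosedImmersion_of_surjective e').homeomorph
  -- the corresponding component of `X ×_Y Spec K` and its three points
  obtain ⟨hC, -⟩ := topologicalKrullDim_image_of_mem_irreducibleComponents e hC'
  have h := h3 K (y ≫ ψ) (e '' C') hC
  -- pull the three points back
  have hsub : e ⁻¹' (e '' C' ∩ (pullback.fst f (y ≫ ψ)) ⁻¹' ((f.smoothLocus : Set X) ∩ Z)) ⊆
      C' ∩ (pullback.fst (ι ≫ pullback.snd f ψ) y) ⁻¹' (((ι ≫ pullback.snd f ψ).smoothLocus : Set X') ∩ (ι ≫ pullback.fst f ψ) ⁻¹' Z) := by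
    rintro x ⟨hxC, hxZ⟩
    refine ⟨(e.injective.mem_set_image).mp hxC, ?_⟩
    have hx : (ι ≫ pullback.fst f ψ) (pullback.fst (ι ≫ pullback.snd f ψ) y x) ∈ (f.smoothLocus : Set X) ∩ Z := by
      have : pullback.fst f (y ≫ ψ) (e x) = (ι ≫ pullback.fst f ψ) (pullback.fst (ι ≫ pullback.snd f ψ) y x) := by
        change (e' ≫ pullback.fst f (y ≫ ψ)) x = _
        rw [he']
        rfl
      rw [← this]
      exact hxZ
    refine ⟨?_, hx.2⟩
    show pullback.fst (ι ≫ pullback.snd f ψ) y x ∈ (ι ≫ pullback.snd f ψ).smoothLocus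
    apply preimage_preimage_smoothLocus_le f ψ ι
    exact hx.1
  calc (3 : ℕ∞) ≤ _ := h
    _ = (e ⁻¹' (e '' C' ∩ (pullback.fst f (y ≫ ψ)) ⁻¹' ((f.smoothLocus : Set X) ∩ Z))).encard :=
        (Set.encard_preimage_of_bijective e.bijective _).symm
    _ ≤ _ := Set.encard_le_encard hsub

/-! ## (vi) d) for `(X', Z')` -/

/-- In a noetherian space, a dense open contains every generic point of an irreducible
component (the complement of the other components is an open neighbourhood of the generic
point inside its component). [folklore] -/
theorem mem_of_dense_of_mem_genericPoints {α : Type*} [TopologicalSpace α] [NoetherianSpace α]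
    {V : Set α} (hVo : IsOpen V) (hVd : Dense V) {a : α} (ha : a ∈ genericPoints α) : a ∈ V := by
  have hC : closure {a} ∈ irreducibleComponents α := ha
  set O : Set α := (⋃₀ (irreducibleComponents α \ {closure {a}}))ᶜ with hO
  have hOopen : IsOpen O := by
    rw [hO, Set.sUnion_eq_biUnion, isOpen_compl_iff]
    exact (NoetherianSpace.finite_irreducibleComponents.subset fun W hW => hW.1).isClosed_biUnion
      fun W hW => isClosed_of_mem_irreducibleComponents W hW.1
  have haO : a ∈ O := by
    rintro ⟨W, ⟨hW, hWne⟩, haW⟩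
    apply hWne
    have h1 : closure {a} ⊆ W :=
      closure_minimal (Set.singleton_subset_iff.mpr haW) (isClosed_of_mem_irreducibleComponents W hW)
    exact Set.Subset.antisymm (hC.2 hW.1 h1) h1
  obtain ⟨w, hwO, hwV⟩ := hVd.inter_open_nonempty O hOopen ⟨a, haO⟩
  have hwC : w ∈ closure {a} := by
    by_contra hw
    exact hwO ⟨irreducibleComponent w, ⟨irreducibleComponent_mem_irreducibleComponents w,
      fun h => hw (h ▸ mem_irreducibleComponent)⟩, mem_irreducibleComponent⟩
  exact (specializes_iff_mem_closure.mpr hwC).mem_open hVo hwV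

/-- A point of the source of an integral (e.g. finite) morphism lying over the generic point of
an irreducible target is a generic point of an irreducible component of the source: there are
no specialisations within a fibre of an integral morphism (`eq_of_specializes_of_isIntegralHom`).
[folklore] -/
theorem mem_genericPoints_of_apply_eq_genericPoint {A B : Scheme.{u}} (p : A ⟶ B) [IsIntegralHom p]
    [IrreducibleSpace B] {a : A} (ha : p a = genericPoint B) : a ∈ genericPoints A := by
  rw [mem_genericPoints_iff_isMax]
  intro b hab
  have hba : b ⤳ a := Scheme.le_iff_specializes.mp hab
  have hpb : p b = genericPoint B := by
    have h1 : p b ⤳ genericPoint B := ha ▸ hba.map p.continuous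
    exact (h1.antisymm (genericPoint_specializes (p b))).eq
  rw [eq_of_specializes_of_isIntegralHom p hba (hpb.trans ha.symm)]

open Scheme.IdealSheafData in
/-- **The reduced base change of the multisection**: for `Z ⊆ X` closed with its reduced structure
`Z_red ↪ X`, the canonical `Z_red ×_Y Y' → X ×_Y Y'` is a closed immersion with image
`pr_X⁻¹(Z)`, over `Z_red` and over `Y'`. [folklore] -/
theorem exists_pullback_vanishingIdeal_to_pullback {Z : Set X} (hZ : IsClosed Z) :
    ∃ m : pullback ((vanishingIdeal ⟨Z, hZ⟩).subschemeι ≫ f) ψ ⟶ pullback f ψ,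
      IsClosedImmersion m ∧
        m ≫ pullback.snd f ψ = pullback.snd ((vanishingIdeal ⟨Z, hZ⟩).subschemeι ≫ f) ψ ∧
          m ≫ pullback.fst f ψ =
            pullback.fst ((vanishingIdeal ⟨Z, hZ⟩).subschemeι ≫ f) ψ ≫ (vanishingIdeal ⟨Z, hZ⟩).subschemeι ∧
            Set.range m = pullback.fst f ψ ⁻¹' Z := by
  set zι := (vanishingIdeal (⟨Z, hZ⟩ : Closeds X)).subschemeι with hzι
  refine ⟨(pullbackRightPullbackFstIso f ψ zι).inv ≫ pullback.snd zι (pullback.fst f ψ),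
    inferInstance, ?_, ?_, ?_⟩
  · rw [Category.assoc, pullbackRightPullbackFstIso_inv_snd_snd]
  · rw [Category.assoc, pullbackRightPullbackFstIso_inv_snd_fst]
  · rw [Scheme.Hom.comp_base, TopCat.coe_comp, Set.range_comp,
      Set.range_eq_univ.mpr (pullbackRightPullbackFstIso f ψ zι).inv.surjective, Set.image_univ,
      Scheme.Pullback.range_snd, range_subschemeι_vanishingIdeal]
    rfl

open Scheme.IdealSheafData in
/-- **(vi) d) for `(X', Z')`** (de Jong 1996, 4.15: "Finally, (vi) d) is trivial to verify for
`f'|_{Z'}`"). Let `Z ⊆ X` be closed with `f|_Z : Z_red → Y` finite and generically étale, and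
`Z' = φ⁻¹(Z) ⊆ X'` the support of an effective Cartier divisor. Then `f'|_{Z'} : Z'_red → Y'` is
finite and generically étale. Finite: `Z'_red` is a closed subscheme (it is reduced and maps onto)
of `Z_red ×_Y Y'`, which is finite over `Y'`. Generically étale: if `f|_Z` is étale on the dense
open `V₀ ⊆ Z_red`, then `Z_red ×_Y Y'` is étale over `Y'` — hence reduced — on the preimage `W₀`
of `V₀`, so `Z'_red → Z_red ×_Y Y'`, a surjective closed immersion, is an isomorphism over `W₀` and
`f'|_{Z'}` is étale on the preimage `W'` of `W₀`; and `W'` is dense in `Z'_red`: every point of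
`Z'` is a specialisation of a point `ξ ∈ Z'` of coheight `≤ 1` (Krull), which lies over the
generic point of `Y'` ("any component dominates", `apply_eq_genericPoint_of_coheight_le_one`),
so `φ(ξ) ∈ Z` lies over the generic point of `Y`, is a generic point of a component of `Z_red`
(`f|_Z` is finite), hence lies in the dense open `V₀`. [cite: DeJong1996, 4.15, p. 71] -/
theorem isFiniteGenericallyEtaleOn [IsIntegral X] [IsIntegral X'] [IsIntegral Y] [IsIntegral Y']
    [NoetherianSpace X] [IsLocallyNoetherian X'] [IsDominant ψ] [Surjective f]
    [LocallyOfFiniteType f] [LocallyOfFiniteType (ι ≫ pullback.snd f ψ)]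
    (hdim : ∀ (y : Y), ∀ C ∈ irreducibleComponents ↥(f.fiber y), topologicalKrullDim ↥C = 1)
    {Z : Set X} (hZ : IsClosed Z) (hd : IsFiniteGenericallyEtaleOn f Z)
    (hI' : ∃ I' : X'.IdealSheafData, IsEffectiveCartier I' ∧
      (I'.support : Set X') = (ι ≫ pullback.fst f ψ) ⁻¹' Z) :
    IsFiniteGenericallyEtaleOn (ι ≫ pullback.snd f ψ) ((ι ≫ pullback.fst f ψ) ⁻¹' Z) := by
  -- notation
  have eZ : (⟨closure Z, isClosed_closure⟩ : Closeds X) = ⟨Z, hZ⟩ := by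
    ext1
    exact hZ.closure_eq
  set Z' : Set X' := (ι ≫ pullback.fst f ψ) ⁻¹' Z with hZ'def
  have hZ' : IsClosed Z' := hZ.preimage (ι ≫ pullback.fst f ψ).continuous
  have eZ' : (⟨closure Z', isClosed_closure⟩ : Closeds X') = ⟨Z', hZ'⟩ := by
    ext1
    exact hZ'.closure_eq
  unfold IsFiniteGenericallyEtaleOn at hd ⊢
  rw [eZ] at hd
  rw [eZ']
  obtain ⟨hfin, V₀, hV₀d, hV₀et⟩ := hd
  haveI := hfin
  haveI := hV₀et
  set zι := (vanishingIdeal (⟨Z, hZ⟩ : Closeds X)).subschemeι with hzι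
  set z'ι := (vanishingIdeal (⟨Z', hZ'⟩ : Closeds X')).subschemeι with hz'ι
  set f' := ι ≫ pullback.snd f ψ with hf'
  -- the reduced base change `T = Z_red ×_Y Y'` and its closed immersion `m` into `X ×_Y Y'`
  obtain ⟨m, hm, hmsnd, hmfst, hmrange⟩ := exists_pullback_vanishingIdeal_to_pullback f ψ hZ
  haveI := hm
  -- the lift `ℓ : Z'_red → T` of `z'ι ≫ ι`
  haveI : IsReduced (vanishingIdeal (⟨Z', hZ'⟩ : Closeds X')).subscheme :=
    isReduced_subscheme_vanishingIdeal _
  have hrange : Set.range (z'ι ≫ ι) ⊆ Set.range m := by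
    rintro _ ⟨w, rfl⟩
    rw [hmrange]
    show pullback.fst f ψ (ι (z'ι w)) ∈ Z
    exact mem_of_subscheme_vanishingIdeal (⟨Z', hZ'⟩ : Closeds X') w
  let ℓ := IsClosedImmersion.liftOfRange m (z'ι ≫ ι) hrange
  have hℓ : ℓ ≫ m = z'ι ≫ ι := IsClosedImmersion.liftOfRange_fac _ _ _
  haveI : IsClosedImmersion ℓ := by
    have : IsClosedImmersion (ℓ ≫ m) := by rw [hℓ]; infer_instance
    exact IsClosedImmersion.of_comp_isClosedImmersion ℓ m
  haveI : Surjective ℓ := by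
    refine ⟨fun t => ?_⟩
    have ht : m t ∈ Set.range m := ⟨t, rfl⟩
    rw [hmrange] at ht
    obtain ⟨x', hx'⟩ := ι.surjective (m t)
    have hx'Z : x' ∈ Z' := by
      show pullback.fst f ψ (ι x') ∈ Z
      rw [hx']
      exact ht
    obtain ⟨w, hw⟩ : x' ∈ Set.range z'ι := by
      rw [range_subschemeι_vanishingIdeal]
      exact hx'Z
    refine ⟨w, m.isClosedEmbedding.injective ?_⟩
    rw [← Scheme.Hom.comp_apply, hℓ, Scheme.Hom.comp_apply, hw, hx']
  have hcomp : z'ι ≫ f' = ℓ ≫ pullback.snd (zι ≫ f) ψ := by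
    rw [hf', ← Category.assoc, ← hℓ, Category.assoc, hmsnd]
  refine ⟨?_, ?_⟩
  · -- finite
    rw [hcomp]
    infer_instance
  · -- generically étale: étale on `W' = ℓ⁻¹(pr⁻¹ V₀)`
    set W₀ : (pullback (zι ≫ f) ψ).Opens := pullback.fst (zι ≫ f) ψ ⁻¹ᵁ V₀ with hW₀
    haveI : Etale (W₀.ι ≫ pullback.snd (zι ≫ f) ψ) :=
      ι_comp_pullback_snd_of_ι_comp (P := @Etale) (zι ≫ f) ψ V₀ hV₀et
    haveI : IsReduced (W₀ : Scheme.{u}) :=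
      isReduced_of_etale_of_isIntegral (W₀.ι ≫ pullback.snd (zι ≫ f) ψ)
    haveI : IsIso (ℓ ∣_ W₀) := isIso_morphismRestrict_of_isClosedImmersion_of_surjective ℓ W₀
    refine ⟨ℓ ⁻¹ᵁ W₀, ?_, ?_⟩
    · -- density: via points of coheight `≤ 1`
      haveI : Surjective f' := by rw [hf']; infer_instance
      have hdim' := topologicalKrullDim_fiber_comp_snd f ψ ι hdim
      have hfin' : ∀ y' : Y', (Z' ∩ f' ⁻¹' {y'}).Finite := fun y' => by
        haveI : IsFinite (z'ι ≫ f') := by rw [hcomp]; infer_instance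
        refine (((z'ι ≫ f').finite_preimage_singleton y').image z'ι).subset ?_
        rintro x ⟨hxZ, hxy⟩
        obtain ⟨w, rfl⟩ : x ∈ Set.range z'ι := by rw [range_subschemeι_vanishingIdeal]; exact hxZ
        exact ⟨w, show (z'ι ≫ f') w ∈ ({y'} : Set Y') by rw [Scheme.Hom.comp_apply]; exact hxy, rfl⟩
      obtain ⟨I', hI'c, hI'Z⟩ := hI'
      haveI : NoetherianSpace (vanishingIdeal (⟨Z, hZ⟩ : Closeds X)).subscheme :=
        zι.isClosedEmbedding.isEmbedding.isInducing.noetherianSpace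
      rw [dense_iff_inter_open]
      rintro G hG ⟨w₀, hw₀⟩
      obtain ⟨G', hG', rfl⟩ := z'ι.isClosedEmbedding.isInducing.isOpen_iff.mp hG
      have hx₀ : z'ι w₀ ∈ I'.support := by
        show z'ι w₀ ∈ (I'.support : Set X')
        rw [hI'Z]
        exact mem_of_subscheme_vanishingIdeal (⟨Z', hZ'⟩ : Closeds X') w₀
      obtain ⟨ξ, hξZ, hξx, hξco⟩ := hI'c.exists_specializes_coheight_le_one hx₀
      have hξZ' : ξ ∈ Z' := by
        have : ξ ∈ (I'.support : Set X') := hξZ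
        rwa [hI'Z] at this
      have hfξ : f' ξ = genericPoint Y' :=
        apply_eq_genericPoint_of_coheight_le_one f' hdim' hZ' hfin' hξZ' hξco
      obtain ⟨w₁, rfl⟩ : ξ ∈ Set.range z'ι := by rw [range_subschemeι_vanishingIdeal]; exact hξZ'
      -- `w₁ ∈ G'`-preimage and `w₁ ∈ W'`
      have hw₁G : w₁ ∈ z'ι ⁻¹' G' :=
        ((z'ι.isClosedEmbedding.isInducing.specializes_iff).mp hξx).mem_open hG hw₀
      refine ⟨w₁, hw₁G, ?_⟩
      -- the point `a = pr (ℓ w₁)` of `Z_red` lies over the generic point of `Y`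
      show pullback.fst (zι ≫ f) ψ (ℓ w₁) ∈ V₀
      set a := pullback.fst (zι ≫ f) ψ (ℓ w₁) with ha
      have hψη : ψ (genericPoint Y') = genericPoint Y := genericPoint_eq_of_isDominant ψ
      have hfa : (zι ≫ f) a = genericPoint Y := by
        have h1 : pullback.snd (zι ≫ f) ψ (ℓ w₁) = f' (z'ι w₁) := by
          rw [← Scheme.Hom.comp_apply, ← hcomp, Scheme.Hom.comp_apply]
        rw [ha, ← Scheme.Hom.comp_apply, pullback.condition, Scheme.Hom.comp_apply, h1, hfξ, hψη]
      exact mem_of_dense_of_mem_genericPoints V₀.isOpen hV₀d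
        (mem_genericPoints_of_apply_eq_genericPoint (zι ≫ f) hfa)
    · -- étale on `W'`
      have e : (ℓ ⁻¹ᵁ W₀).ι ≫ z'ι ≫ f' = (ℓ ∣_ W₀) ≫ W₀.ι ≫ pullback.snd (zι ≫ f) ψ := by
        rw [hcomp, morphismRestrict_ι_assoc]
      rw [e]
      infer_instance


end DeJong1996.StrictTransform

/-! ## 4.15 PROVED -/

open Scheme.IdealSheafData in
/-- **de Jong 1996, 4.15 — the named fact `DeJong1996StrictTransform` PROVED.** For a fibred pair
`(X, Z)` over `Y` with (vi) e) and a generically étale alteration `ψ : Y' → Y` from a projective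
variety, the reduction `X' = (X ×_Y Y')_red` (the reduced closed subscheme of Mathlib's
`pullback f ψ` on its whole space, with its inclusion `ι`) is, with `f' = ι ≫ pr_{Y'}`,
`φ = ι ≫ pr_X`, `Z' = φ⁻¹(Z)`, again a fibred pair with (vi) e), and `φ` is a generically étale
alteration: (vi) a)–c) and the integrality of `X'` (`AlterationsStrictTransformProofs`-part),
(iii) (`StrictTransform.isProjectiveOver`), (iv) (`StrictTransform.exists_isEffectiveCartier`),
(vi) d) (`StrictTransform.isFiniteGenericallyEtaleOn`), (vi) e)
(`StrictTransform.hasThreeSmoothPoints`), `φ` (`StrictTransform.isAlteration_comp_fst`,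
`StrictTransform.isGenericallyEtale_comp_fst`). [cite: DeJong1996, 4.15, p. 71] -/
theorem DeJong1996StrictTransform_holds : DeJong1996StrictTransform.{u} := by
  intro k _ _ X Y Y' _ _ f _ g Z ψ hP h3 hψ hψet hproj
  -- instances carried by the data
  haveI := hP.isIntegral
  haveI : IsProper ψ := hψ.isProper
  haveI : Surjective ψ := hψ.surjective
  haveI : IsDominant ψ := hψ.isDominant
  haveI : Surjective f := hP.isCurveFibration.surjective
  haveI : GeometricallyConnected f := hP.isCurveFibration.geometricallyConnected
  haveI : IsProper g :=
    Literature.AlgebraicGeometry.Motives.IsProjectiveOver.isProper (X := Over.mk g)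
      hP.isProjectiveOver_base
  haveI := hP.locallyOfFiniteType
  haveI := hP.quasiCompact
  haveI : IsLocallyNoetherian X := LocallyOfFiniteType.isLocallyNoetherian (f ≫ g)
  haveI : CompactSpace X := QuasiCompact.compactSpace_of_compactSpace (f ≫ g)
  haveI : IsNoetherian X := {}
  haveI : IsProper (ψ ≫ g) :=
    Literature.AlgebraicGeometry.Motives.IsProjectiveOver.isProper (X := Over.mk (ψ ≫ g)) hproj
  haveI : IsLocallyNoetherian Y' := LocallyOfFiniteType.isLocallyNoetherian (ψ ≫ g)
  -- the reduction `X'` of `X ×_Y Y'`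
  haveI : IsReduced (vanishingIdeal (⊤ : Closeds ↥(pullback f ψ))).subscheme :=
    isReduced_subscheme_vanishingIdeal ⊤
  haveI : Surjective (vanishingIdeal (⊤ : Closeds ↥(pullback f ψ))).subschemeι := by
    refine ⟨fun p => ?_⟩
    have : p ∈ Set.range (vanishingIdeal (⊤ : Closeds ↥(pullback f ψ))).subschemeι := by
      rw [range_subschemeι_vanishingIdeal]
      trivial
    exact this
  haveI : IsLocallyNoetherian (vanishingIdeal (⊤ : Closeds ↥(pullback f ψ))).subscheme :=
    LocallyOfFiniteType.isLocallyNoetherian (vanishingIdeal (⊤ : Closeds ↥(pullback f ψ))).subschemeι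
  haveI : LocallyOfFinitePresentation
      ((vanishingIdeal (⊤ : Closeds ↥(pullback f ψ))).subschemeι ≫ pullback.snd f ψ) :=
    inferInstance
  haveI : Nonempty (vanishingIdeal (⊤ : Closeds ↥(pullback f ψ))).subscheme := by
    haveI : Surjective ((vanishingIdeal (⊤ : Closeds ↥(pullback f ψ))).subschemeι ≫
      pullback.snd f ψ) := inferInstance
    obtain ⟨x, -⟩ := ((vanishingIdeal (⊤ : Closeds ↥(pullback f ψ))).subschemeι ≫
      pullback.snd f ψ).surjective (Classical.arbitrary Y')
    exact ⟨x⟩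
  haveI : IsIntegral (vanishingIdeal (⊤ : Closeds ↥(pullback f ψ))).subscheme :=
    DeJong1996.StrictTransform.isIntegral f ψ (vanishingIdeal (⊤ : Closeds ↥(pullback f ψ))).subschemeι
      hP.isCurveFibration.smooth_fiberToSpecResidueField_genericPoint
      hP.isCurveFibration.dense_preimage_smoothLocus
  have hdim := hP.isCurveFibration.topologicalKrullDim_eq_one
  have hD' := DeJong1996.StrictTransform.exists_isEffectiveCartier f ψ
    (vanishingIdeal (⊤ : Closeds ↥(pullback f ψ))).subschemeι hP.exists_isEffectiveCartier
  refine ⟨(vanishingIdeal (⊤ : Closeds ↥(pullback f ψ))).subscheme,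
    (vanishingIdeal (⊤ : Closeds ↥(pullback f ψ))).subschemeι, inferInstance, inferInstance,
    inferInstance, inferInstance, ?_, ?_, ?_, ?_⟩
  · exact
      { isIntegral := inferInstance
        isProjectiveOver := DeJong1996.StrictTransform.isProjectiveOver f ψ _ g
          hP.isProjectiveOver hproj
        exists_isEffectiveCartier := hD'
        isProjectiveOver_base := hproj
        isCurveFibration :=
          { locallyOfFinitePresentation := inferInstance
            surjective := inferInstance
            geometricallyConnected := DeJong1996.StrictTransform.geometricallyConnected_comp_snd f ψ _
            topologicalKrullDim_eq_one :=
              DeJong1996.StrictTransform.topologicalKrullDim_fiber_comp_snd f ψ _ hdim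
            dense_preimage_smoothLocus :=
              DeJong1996.StrictTransform.dense_preimage_smoothLocus_comp_snd f ψ _
                hP.isCurveFibration.dense_preimage_smoothLocus
            smooth_fiberToSpecResidueField_genericPoint :=
              DeJong1996.StrictTransform.smooth_fiberToSpecResidueField_genericPoint_comp_snd f ψ _
                hP.isCurveFibration.smooth_fiberToSpecResidueField_genericPoint }
        isFiniteGenericallyEtaleOn :=
          DeJong1996.StrictTransform.isFiniteGenericallyEtaleOn f ψ _ hdim hP.isClosed
            hP.isFiniteGenericallyEtaleOn hD' }
  · exact DeJong1996.StrictTransform.hasThreeSmoothPoints f ψ _ h3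
  · exact DeJong1996.StrictTransform.isAlteration_comp_fst f ψ _ hψ
  · exact DeJong1996.StrictTransform.isGenericallyEtale_comp_fst f ψ _ hψet

/-- **`DeJong1996SectionsReduction` (4.15–4.16) from the Galois normalisation alone**: with 4.15
proved, the node 4.15–4.16 of the decomposition of
`DeJong1996MultisectionToPreSemiStablePair` rests on `DeJong1996GaloisNormalization` only.
[cite: DeJong1996, 4.15–4.16, p. 71] -/
theorem DeJong1996SectionsReduction.of_galoisNormalization (h416 : DeJong1996GaloisNormalization.{u}) :
    DeJong1996SectionsReduction.{u} :=
  DeJong1996SectionsReduction.of_strictTransform_of_galoisNormalization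
    DeJong1996StrictTransform_holds h416

/-- **`DeJong1996MultisectionToPreSemiStablePair` (4.15–4.22a) from three named inputs**: 4.16
(`DeJong1996GaloisNormalization`), 4.17 (`DeJong1996StableModelReduction`) and 4.18–4.21 with
the opening of 4.22 (`DeJong1996StableModelToMorphism`) — 4.15 and the rest of 4.22 being
proved. [cite: DeJong1996, 4.15–4.22, pp. 71–74] -/
theorem DeJong1996MultisectionToPreSemiStablePair.of_galoisNormalization_of_stableModel_of_toMorphism
    (h416 : DeJong1996GaloisNormalization.{u}) (h417 : DeJong1996StableModelReduction.{u})
    (h418 : DeJong1996StableModelToMorphism.{u}) :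
    DeJong1996MultisectionToPreSemiStablePair.{u} :=
  DeJong1996MultisectionToPreSemiStablePair.of_sections_of_stableModel_of_toMorphism
    (DeJong1996SectionsReduction.of_galoisNormalization h416) h417 h418


end Literature.AlgebraicGeometry.Resolution

end
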